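import Mathlib
import Summits.KontsevichZagierPeriods.Zeta5Search.Families.RayGrowthDuality
import Summits.KontsevichZagierPeriods.Zeta5Search.Families.ExactDualityBZ
import Summits.KontsevichZagierPeriods.Zeta5Search.Families.CellularBrownZudilin
import Summits.KontsevichZagierPeriods.Zeta5Search.Brown8.RecordQRateWindow
import Literature.NumberTheory.Irrationality.BrownZudilin2022.GeneralFamily
import HarnessLib

/-!
# ζ(5) search — Families: CONJECTURE D — the leading coefficient of the Brown–Zudilin forms is the constant term of the integrand on the DUAL cell

HONEST FRAMING: systematic search; no irrationality claim unless certified.  This file TYPES two cell-internal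
CONJECTURES (tagged `@[conjecture]`, INTERNALLY MINTED, nothing in the tree uses them as hypotheses of a record) and
proves what follows from them for the record ray; nothing about the arithmetic of ζ(5) and no number of record moves.
Evidence: `HOME/pub-zeta5-p2/g6/DUAL-RATES.md` (seat P2 g6).

Setting.  `σ = ₈π₈^∨ = pi8dual`, `τ = σ⁻¹ = ₈π₈ = pi8dualInv`; for `a ∈ ℤ⁸` the cellular integrand has exponents
`A = bzNum a` on the `δ⁰`-edges and `B = bzDen a` on the `σδ⁰`-edges (`Families/CellularBrownZudilin`).  On the DUAL cell
`X_σ` (real configurations seated in the order `σ`), in the gap coordinates `g₀,…,g₅` of `w = z ∘ σ`, the `σδ⁰`-edges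
of `z` are the single gaps and the finite `τδ⁰`-chords are the spans `{1,2}, {1,…,5}, {2,…,5}, {2,3,4}, {0,…,3},
{0,1,2}` (edges at positions `0,1,2,3,6,7` of `τ`; positions `4,5` pass through `∞`), so the integrand is the degree-0
Laurent polynomial `Λ_a = dualSpanProd A / g^B` with NON-NEGATIVE coefficients.
* `dualSpanProd`, `dualConstantTerm a = [g^B] dualSpanProd (bzNum a)` (an `MvPolynomial` coefficient);
* **`LeadingCoeffIsDualConstantTerm`** (CONJECTURE D-exact): `|Q(a)| = dualConstantTerm a` whenever `A, B ≥ 0` —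
  VERIFIED EXACTLY on 30 parameter vectors (the diagonal `Q₁…Q₄ = 21, 2989, 714549, 217515501`, …; `ct_test.py`);
* **`LeadingCoeffRateIsDualDecay`** (CONJECTURE D): on BZ's cone `log|Q(a·n)|/n → −log raySup(τ; B, A)` = the log of the
  MINIMUM of the integrand over the dual cell (`Families/RayGrowthDuality.inv_raySup_dual_eq_sInf_dualCell`) — 38-digit
  agreement on the record ray (`Families/ExactDualRecordRay*`), exact on the diagonal (`λ₃`,
  `Families/BasicGrowthDualityExtrema`);
* PROVED: `recordQRate_eq_of_conjD` — Conjecture D implies that the printed growth rate of the record coefficients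
  ([BrownZudilin2022, §11]; the tree limit `Brown8.recordQRate`) IS `−log raySup(₈π₈; bzDen a, bzNum a)`, an explicit
  algebraic closed form (`Families/ExactDualRecordRayExact`); `conjD_exact_diag_one` — the `n = 1` diagonal instance of
  D-exact's `Q`-side: `Q(1,…,1) = 21` (`decide`).
UPDATE (retag, P2 g8, 2026-08-22): BOTH statements are now THEOREMS of the tree — `DualR.leadingCoeffIsDualConstantTerm_holds`
(`Families/DualExactFullCone`, cert-2 g8) and `DualRate.leadingCoeffRateIsDualDecay_holds` (`Families/DualRateConjectureD`,
cert-2 g9); the `@[conjecture]` attributes are therefore removed; statements and names unchanged (the word CONJECTURE in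
the docstrings below is historical).
Standard axioms only.
-/

noncomputable section

open Filter Topology MvPolynomial
open Literature.NumberTheory.Irrationality

namespace Summit.KontsevichZagierPeriods.Zeta5Search.Families.Cellular

/-- The numerator of the dual Laurent polynomial: the product over the six finite edges of `₈π₈ = (3,1,6,2,5,7,4,0)` of
`(Σ_{w ∈ span} g_w)^{A_e}`, `A = bzNum a` by position (`A₄, A₅` belong to the two edges through `∞` and do not occur). -/
def dualSpanProd (A : Fin 8 → ℕ) : MvPolynomial (Fin 6) ℤ :=
  (X 1 + X 2) ^ A 0 * (X 1 + X 2 + X 3 + X 4 + X 5) ^ A 1 * (X 2 + X 3 + X 4 + X 5) ^ A 2 *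
    (X 2 + X 3 + X 4) ^ A 3 * (X 0 + X 1 + X 2 + X 3) ^ A 6 * (X 0 + X 1 + X 2) ^ A 7

/-- **The dual constant term** `CT[Λ_a] = [g₀^{B₀}⋯g₅^{B₅}] dualSpanProd (bzNum a)`, `B = bzDen a` restricted to the six
gaps (`B₆, B₇` sit on the `δ⁰`-edges of `w` through `∞`).  Equivalently: the number of non-negative integer transport
tables between the six finite edges (row sums `A_e`) and the six gaps (column sums `B_w`), weighted by the row
multinomials. -/
def dualConstantTerm (a : Fin 8 → ℤ) : ℤ :=
  MvPolynomial.coeff (Finsupp.equivFunOnFinite.symm fun w : Fin 6 => (bzDen a (Fin.castLE (by norm_num) w)).toNat)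
    (dualSpanProd fun i => (bzNum a i).toNat)

/-- **CONJECTURE D-exact (INTERNALLY MINTED; P2 g6).**  For every `a ∈ ℤ⁸` with `bzNum a ≥ 0` and `bzDen a ≥ 0`, the
absolute value of Brown–Zudilin's leading coefficient `Q(a) = Q(p(a); q(a))` of (17) equals the constant term of the
cellular integrand in the gap coordinates of the dual cell: `|Q(a)| = dualConstantTerm a` (the sign of `Q` being
`(−1)^{Σ p_i(a)}`).  Evidence: 30/30 exact checks (`HOME/pub-zeta5-p2/g6/ct_test*.py`).  Expected mechanism: the
iterated residue of `F_a ω` at the vertex of the dual cell. [evidence: HOME/pub-zeta5-p2/g6/DUAL-RATES.md] -/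
def LeadingCoeffIsDualConstantTerm : Prop :=
  ∀ a : Fin 8 → ℤ, (∀ i, 0 ≤ bzNum a i) → (∀ i, 0 ≤ bzDen a i) →
    |BrownZudilin2022.QOf a| = dualConstantTerm a

/-- **CONJECTURE D (duality of rates; INTERNALLY MINTED; P2 g6).**  For every `a` in the Brown–Zudilin cone the
leading coefficients grow like the reciprocal of the decay of the DUAL cellular family:
`log|Q(a·n)|/n → −log raySup(₈π₈; bzDen a, bzNum a)` (`= log min_{X_{₈π₈^∨}} F_a` by
`Families/RayGrowthDuality`).  Evidence: 38 digits on the record ray, exact on the diagonal, ~10⁻⁵ (extrapolation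
error) on seven more rays; implied by D-exact via constant-term asymptotics. [evidence: HOME/pub-zeta5-p2/g6/DUAL-RATES.md] -/
def LeadingCoeffRateIsDualDecay : Prop :=
  ∀ a : Fin 8 → ℤ, BrownZudilin2022.Converges a →
    Tendsto (fun n : ℕ => Real.log |(BrownZudilin2022.QOf (fun i => (n : ℤ) * a i) : ℝ)| / n) atTop
      (𝓝 (-Real.log (raySup pi8dualInv (bzDen a) (bzNum a))))

/-- **Conjecture D pins the printed rate**: if D holds, the growth rate `recordQRate = lim log|Q(a·n)|/n` of the record
coefficients (`a = (8,16,10,15,12,16,18,13)`; [BrownZudilin2022, §11], tree `Brown8.recordQRate ∈ [85.08768883,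
85.08768884]`) equals `−log raySup(₈π₈; bzDen a, bzNum a)`, the explicit algebraic closed form of
`Families/ExactDualRecordRayExact` (numerically `85.0876888342863722906…`). -/
theorem recordQRate_eq_of_conjD (hD : LeadingCoeffRateIsDualDecay) :
    Brown8.recordQRate =
      -Real.log (raySup pi8dualInv (bzDen BrownZudilin2022.recordVec) (bzNum BrownZudilin2022.recordVec)) := by
  have h1 := Brown8.tendsto_log_abs_recordQ_div
  have h2 := hD BrownZudilin2022.recordVec BrownZudilin2022.converges_thm1_vector
  have h3 : (fun n : ℕ => Real.log |(RecordRay.recordQ n : ℝ)| / n) =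
      fun n : ℕ => Real.log |(BrownZudilin2022.QOf (fun i => (n : ℤ) * BrownZudilin2022.recordVec i) : ℝ)| / n := by
    funext n
    rw [Brown8.recordQ_eq_QOf]
  rw [h3] at h1
  exact tendsto_nhds_unique h1 h2

/-- The `Q`-side of the first diagonal instance of D-exact: `Q(1,…,1) = 21` (Zudilin's `Q₁`; the dual side — the number
of perfect matchings between the six finite edges of `₈π₈` and the six gaps they cover — is `21` as well, checked outside
the kernel). -/
theorem conjD_exact_diag_one : BrownZudilin2022.QOf (fun _ => 1) = 21 := by
  decide

end Summit.KontsevichZagierPeriods.Zeta5Search.Families.Cellular
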